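import Mathlib

/-!
# Wall bubbling for `DoorA26` — (W-split)/(R) LINKING LAW: the TWO-SLOPE TOP CLASS of a vanishing minor across two cluster scales

HONEST FRAMING.  Helper theorems for the line `Cruxes/DoorA26/Lines/wall_bubbling.lean` (crux stmt-ValiantsHypothesis-19979 `DoorA26`
= `PosRootLawAt 2 6 19`; OPEN, typed, never asserted), W2 seat val-sym-door-p1 g16; obligations (W) (residual `NoTightChain26NC` of
`Cruxes/DoorA26/Lines/wall_bubbling_ConfluentDoor.lean` rev 6), (M) (the «staircase» residual of memo rev 13 §4.9/§7) and (R) (interior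
accumulation).  This is the LINKING input the line lead's memo rev 13 §7.2 (ℓ2) asks for («NO LEXICOGRAPHIC ROWS ⇒ NO LINKING»), in CLOSED FORM
for two consecutive clusters of a tight chain: pure real analysis + the Leibniz formula, def-free, Mathlib-only.  Nothing here is a door; nothing here
bears on `DoorA26`, `MatrixDescartes` (stmt-ValiantsHypothesis-18050) or `VP ≠ VNP`; registers `ζ_sym(2,6) ∈ {18,19,20}`, `ζ_sym(3,4) ∈ {18,19}` unchanged.

THE LAW.  Along a tight chain (W2 #26 `tightChain`, #28 `interval_count_tight`) with two consecutive clusters at centres `s₁^ν < s₂^ν`,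
`L^ν = s₂^ν − s₁^ν → ∞`, EVERY Gram entry has exact exponential asymptotics: a member `pq` whose value `w = δ_p + δ_q` lies below the hinge value `v`
satisfies `G^ν_pq · e^{w s₁}/μ₁ → Γ₁(pq)`, above the hinge `G^ν_pq · e^{w s₂}/μ₂ → Γ₂(pq)`, and a hinge member alive in both clusters fixes
`(μ₂/μ₁)e^{−vL} → κ = Γ₁(h)/Γ₂(h) ≠ 0` (`twoSlope_dictionary`, §4; cf. W2 #29 `scaleRatio_lower/upper`).  After the row/column rescaling
`R_p C_q = μ₁ e^{−v s₁ − s̄(w − v)}` (`s̄ = (s₁+s₂)/2`) this reads `G_pq /(R_p C_q) · e^{(L/2)|w − v|} → γ_pq` with `γ = Γ₁` below and `κΓ₂` above the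
hinge — ONE glued matrix `γ`, all of whose entries at alive members are non-zero.  Since the Gram has rank `≤ 3` (W1 #21 `realisable_det_submatrix`),
every `k × k` minor, `k ≥ 4`, vanishes for every `ν`; dividing the Leibniz expansion by the σ-independent normaliser and by `e^{−(L/2)·A_min}` and
letting `ν → ∞` gives the **TWO-SLOPE TOP-CLASS BALANCE** (`minor_topClass_sum_eq_zero`, §2, from the abstract `topClass_sum_eq_zero`, §1):
  `Σ_{σ : A(σ) = A_min} sign σ · Π_i γ_{r(σ i), c(i)} = 0`,  `A(σ) := Σ_i |w_{r(σ i) c(i)} − v|`  (the ℓ¹-distance of the monomial's values to the hinge).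
One-sided classes (all values weakly on one side) balance by `rank Γ_c ≤ 3`; a top class consisting of ONE monomial with non-zero `γ`-product is a
contradiction (`false_of_topClass_singleton`, §3), and so is the class `{σ, σ⁻¹}` of a principal minor for symmetric `γ` (`false_of_topClass_inv_pair`)
— e.g. at generic support, for letters `p₁<p₂<p₃<p₄` whose anti-diagonal values `δp₁+δp₄`, `δp₂+δp₃` are STRICTLY separated by the hinge and no
one-sided matching / structural tie exists.  LOCATED (this seat, kit j321716, exact arithmetic, order-type invariant — 0/148 656 perturbation flips):
at generic support the law kills 29 434 of the 49 552 two-cluster tight-chain profiles (2 608 chambers × 19 hinges) — every profile that the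
door-free NULL COLLAPSE (#32) kills and 1 176 more, ALL profiles with `m_small ∈ {7, 8}`, none with `m_small ≤ 3` (the END doors' territory);
the middle survivors are exactly hinges at an end-letter value `δ₀+δ_q` / `δ_p+δ₅` or a diagonal value `2δ_p`.  The law is stated for any `n`, any
minor size `k`, any excess exponents `a` (multi-slope chains: `a` = the penalty of the dominant gap), so the (M) staircases and (R) use the same rows.

[folklore] Leibniz formula, limits of finite sums/products.  [this work] the closed-form two-scale row and its kill corollaries.
-/

-- `Summit.ValiantsHypothesis.ValiantsHypothesis.…` repeats a component by the D-0017 layout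
-- (single-conjunct summit), which the `dupNamespace` linter flags; the name is mandated.
set_option linter.dupNamespace false

namespace Summit.ValiantsHypothesis.ValiantsHypothesis.Theorems.LacunarySymmetroidMatrixDescartes.WallBubbling

open Finset Filter Topology
open scoped BigOperators

/-! ## §1 Top-class balance with an explicit rate -/

/-- **Top-class balance.**  Finitely many real sequences `X^ν_i` with `Σ_i X^ν_i = 0` for every `ν`, each with an exponential rate:
`X^ν_i · e^{Δ^ν A_i} → c_i`, `Δ^ν → ∞`.  If `m ≤ A_i` for all `i`, the limits on the class `{A_i = m}` sum to zero. [folklore] -/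
theorem topClass_sum_eq_zero {ι : Type*} [Fintype ι] (X : ℕ → ι → ℝ) (c A : ι → ℝ) (Δ : ℕ → ℝ) (m : ℝ)
    (hΔ : Tendsto Δ atTop atTop) (hm : ∀ i, m ≤ A i)
    (hX : ∀ i, Tendsto (fun ν => X ν i * Real.exp (Δ ν * A i)) atTop (𝓝 (c i)))
    (hsum : ∀ ν, ∑ i, X ν i = 0) :
    ∑ i ∈ univ.filter (fun i => A i = m), c i = 0 := by
  classical
  have hlim : ∀ i, Tendsto (fun ν => X ν i * Real.exp (Δ ν * m)) atTop
      (𝓝 (if A i = m then c i else 0)) := by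
    intro i
    have hfac : ∀ ν, X ν i * Real.exp (Δ ν * m)
        = (X ν i * Real.exp (Δ ν * A i)) * Real.exp (-(Δ ν * (A i - m))) := by
      intro ν
      rw [mul_assoc, ← Real.exp_add]
      congr 1
      ring
    simp_rw [hfac]
    by_cases h : A i = m
    · simp only [h, sub_self, mul_zero, neg_zero, Real.exp_zero, mul_one, if_true]
      simpa [h] using hX i
    · have hpos : 0 < A i - m := sub_pos.mpr (lt_of_le_of_ne (hm i) (Ne.symm h))
      have hexp : Tendsto (fun ν => Real.exp (-(Δ ν * (A i - m)))) atTop (𝓝 0) :=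
        Real.tendsto_exp_atBot.comp (tendsto_neg_atTop_atBot.comp (hΔ.atTop_mul_const hpos))
      simpa [h] using (hX i).mul hexp
  have hS : Tendsto (fun ν => ∑ i, X ν i * Real.exp (Δ ν * m)) atTop
      (𝓝 (∑ i, if A i = m then c i else 0)) := tendsto_finsetSum _ fun i _ => hlim i
  have hS0 : ∀ ν, ∑ i, X ν i * Real.exp (Δ ν * m) = 0 := by
    intro ν
    rw [← Finset.sum_mul, hsum ν, zero_mul]
  simp_rw [hS0] at hS
  rw [Finset.sum_filter]
  exact tendsto_nhds_unique hS tendsto_const_nhds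

/-! ## §1′ Robust extraction (ν-dependent exponents): a singleton or an exact pair in the top class -/

/-- **Singleton top class, robust form.**  `Σ_i X^ν_i = 0`; a distinguished index `i₀` with `X^ν_{i₀} e^{E^ν_{i₀}} → c₀`; every other index
has a limit after its own rescaling and an exponent gap `E^ν_i − E^ν_{i₀} → +∞`.  Then `c₀ = 0`.  (Exponents may depend on `ν`: only the
divergence of the gaps is used.) [folklore] -/
theorem topClass_singleton_eq_zero {ι : Type*} [Fintype ι] [DecidableEq ι] (X E : ℕ → ι → ℝ) (c : ι → ℝ) (i₀ : ι)
    (hX : ∀ i, Tendsto (fun ν => X ν i * Real.exp (E ν i)) atTop (𝓝 (c i)))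
    (hgap : ∀ i, i ≠ i₀ → Tendsto (fun ν => E ν i - E ν i₀) atTop atTop)
    (hsum : ∀ ν, ∑ i, X ν i = 0) : c i₀ = 0 := by
  have hlim : ∀ i, Tendsto (fun ν => X ν i * Real.exp (E ν i₀)) atTop (𝓝 (if i = i₀ then c i else 0)) := by
    intro i
    by_cases h : i = i₀
    · subst h; simpa using hX i
    · have hfac : ∀ ν, X ν i * Real.exp (E ν i₀) = (X ν i * Real.exp (E ν i)) * Real.exp (-(E ν i - E ν i₀)) := by
        intro ν; rw [mul_assoc, ← Real.exp_add]; congr 1; ring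
      simp_rw [hfac, if_neg h]
      have hexp : Tendsto (fun ν => Real.exp (-(E ν i - E ν i₀))) atTop (𝓝 0) :=
        Real.tendsto_exp_atBot.comp (tendsto_neg_atTop_atBot.comp (hgap i h))
      simpa using (hX i).mul hexp
  have hS : Tendsto (fun ν => ∑ i, X ν i * Real.exp (E ν i₀)) atTop (𝓝 (∑ i, if i = i₀ then c i else 0)) :=
    tendsto_finsetSum _ fun i _ => hlim i
  have hS0 : ∀ ν, ∑ i, X ν i * Real.exp (E ν i₀) = 0 := by
    intro ν; rw [← Finset.sum_mul, hsum ν, zero_mul]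
  simp_rw [hS0] at hS
  have h := tendsto_nhds_unique hS tendsto_const_nhds
  rw [Finset.sum_ite_eq' Finset.univ i₀ c, if_pos (Finset.mem_univ _)] at h
  exact h

/-- **Exact pair in the top class, robust form.**  As above with two distinguished indices `i₀ ≠ i₁` of IDENTICAL exponents
`E^ν_{i₁} = E^ν_{i₀}` (all `ν`) and all other gaps divergent: `c_{i₀} + c_{i₁} = 0`. [folklore] -/
theorem topClass_pair_eq_zero {ι : Type*} [Fintype ι] [DecidableEq ι] (X E : ℕ → ι → ℝ) (c : ι → ℝ) (i₀ i₁ : ι) (h01 : i₀ ≠ i₁)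
    (hX : ∀ i, Tendsto (fun ν => X ν i * Real.exp (E ν i)) atTop (𝓝 (c i)))
    (hE : ∀ ν, E ν i₁ = E ν i₀)
    (hgap : ∀ i, i ≠ i₀ → i ≠ i₁ → Tendsto (fun ν => E ν i - E ν i₀) atTop atTop)
    (hsum : ∀ ν, ∑ i, X ν i = 0) : c i₀ + c i₁ = 0 := by
  have hlim : ∀ i, Tendsto (fun ν => X ν i * Real.exp (E ν i₀)) atTop
      (𝓝 (if i = i₀ ∨ i = i₁ then c i else 0)) := by
    intro i
    by_cases h : i = i₀
    · subst h; simpa using hX i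
    by_cases h' : i = i₁
    · subst h'; simp_rw [← hE]; simpa [h] using hX i
    · have hfac : ∀ ν, X ν i * Real.exp (E ν i₀) = (X ν i * Real.exp (E ν i)) * Real.exp (-(E ν i - E ν i₀)) := by
        intro ν; rw [mul_assoc, ← Real.exp_add]; congr 1; ring
      simp_rw [hfac, if_neg (not_or.mpr ⟨h, h'⟩)]
      have hexp : Tendsto (fun ν => Real.exp (-(E ν i - E ν i₀))) atTop (𝓝 0) :=
        Real.tendsto_exp_atBot.comp (tendsto_neg_atTop_atBot.comp (hgap i h h'))
      simpa using (hX i).mul hexp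
  have hS : Tendsto (fun ν => ∑ i, X ν i * Real.exp (E ν i₀)) atTop (𝓝 (∑ i, if i = i₀ ∨ i = i₁ then c i else 0)) :=
    tendsto_finsetSum _ fun i _ => hlim i
  have hS0 : ∀ ν, ∑ i, X ν i * Real.exp (E ν i₀) = 0 := by
    intro ν; rw [← Finset.sum_mul, hsum ν, zero_mul]
  simp_rw [hS0] at hS
  have h := tendsto_nhds_unique hS tendsto_const_nhds
  rw [Finset.sum_eq_add i₀ i₁ h01] at h
  · rw [if_pos (Or.inl rfl), if_pos (Or.inr rfl)] at h
    exact h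
  · rintro i - ⟨h0, h1⟩; exact if_neg (not_or.mpr ⟨h0, h1⟩)
  · intro h0; exact absurd (Finset.mem_univ i₀) h0
  · intro h0; exact absurd (Finset.mem_univ i₁) h0

/-! ## §2 The Leibniz expansion of a vanishing minor, two (or more) scales at once -/

/-- The σ-term of the normalised Leibniz expansion and its asymptotics.  `G^ν` square real matrices; entries with asymptotics
`G^ν_pq /(R^ν_p C^ν_q) · e^{Δ^ν a^ν_pq} → γ_pq` (positive row/column normalisers `R, C`, a rate `Δ^ν`, excess exponents `a^ν` which MAY depend on `ν`).
Then for rows `r`, columns `c` and every permutation `σ` the normalised monomial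
`X^ν_σ := sign σ · Π_i G^ν_{r(σ i), c i} / (Π_i R^ν_{r i} · Π_i C^ν_{c i})` satisfies `X^ν_σ · e^{Δ^ν A^ν(σ)} → sign σ · Π_i γ_{r(σ i), c i}`,
`A^ν(σ) := Σ_i a^ν_{r(σ i), c i}`. [this work] -/
theorem minor_term_tendsto {n k : ℕ} (G : ℕ → Matrix (Fin n) (Fin n) ℝ) (r c : Fin k → Fin n)
    (γ : Fin n → Fin n → ℝ) (a : ℕ → Fin n → Fin n → ℝ) (R C : ℕ → Fin n → ℝ) (Δ : ℕ → ℝ)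
    (hG : ∀ p q, Tendsto (fun ν => G ν p q / (R ν p * C ν q) * Real.exp (Δ ν * a ν p q)) atTop (𝓝 (γ p q)))
    (σ : Equiv.Perm (Fin k)) :
    Tendsto (fun ν => (((Equiv.Perm.sign σ : ℤ) : ℝ) * (∏ i, G ν (r (σ i)) (c i)) / ((∏ i, R ν (r i)) * ∏ i, C ν (c i)))
        * Real.exp (Δ ν * ∑ i, a ν (r (σ i)) (c i))) atTop
      (𝓝 (((Equiv.Perm.sign σ : ℤ) : ℝ) * ∏ i, γ (r (σ i)) (c i))) := by
  have hprod : Tendsto (fun ν => ∏ i, (G ν (r (σ i)) (c i) / (R ν (r (σ i)) * C ν (c i))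
      * Real.exp (Δ ν * a ν (r (σ i)) (c i)))) atTop (𝓝 (∏ i, γ (r (σ i)) (c i))) :=
    tendsto_finsetProd _ fun i _ => hG _ _
  refine (hprod.const_mul (((Equiv.Perm.sign σ : ℤ) : ℝ))).congr' (Eventually.of_forall fun ν => ?_)
  have hRσ : ∏ i, R ν (r (σ i)) = ∏ i, R ν (r i) := Equiv.prod_comp σ (fun j => R ν (r j))
  rw [Finset.prod_mul_distrib, Finset.prod_div_distrib, Finset.prod_mul_distrib, ← Real.exp_sum, ← Finset.mul_sum,
    hRσ]
  ring

/-- The normalised Leibniz expansion of a vanishing minor sums to zero. [folklore] -/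
theorem minor_terms_sum_eq_zero {n k : ℕ} (G : ℕ → Matrix (Fin n) (Fin n) ℝ) (r c : Fin k → Fin n)
    (hdet : ∀ ν, ((G ν).submatrix r c).det = 0) (R C : ℕ → Fin n → ℝ) (ν : ℕ) :
    ∑ σ : Equiv.Perm (Fin k), ((Equiv.Perm.sign σ : ℤ) : ℝ) * (∏ i, G ν (r (σ i)) (c i))
      / ((∏ i, R ν (r i)) * ∏ i, C ν (c i)) = 0 := by
  have h := hdet ν
  rw [Matrix.det_apply'] at h
  simp only [Matrix.submatrix_apply] at h
  rw [← Finset.sum_div, h, zero_div]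

/-- **TOP-CLASS BALANCE OF A VANISHING MINOR (fixed excess exponents).**  `k × k` minor on rows `r`, columns `c` vanishing for every `ν`;
entries `G^ν_pq /(R^ν_p C^ν_q) · e^{Δ^ν a_pq} → γ_pq` with `R, C > 0`, `Δ^ν → ∞`, FIXED `a`.  Then on the class minimising `A(σ) = Σ_i a_{r(σ i), c i}`:
`Σ_{A σ = m} sign σ · Π_i γ_{r(σ i), c i} = 0` (`m ≤ A σ` for all `σ`).  For sequences at a fixed support this is the full two-scale row; with
moving supports use the robust forms below. [this work] -/
theorem minor_topClass_sum_eq_zero {n k : ℕ} (G : ℕ → Matrix (Fin n) (Fin n) ℝ) (r c : Fin k → Fin n)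
    (hdet : ∀ ν, ((G ν).submatrix r c).det = 0)
    (γ a : Fin n → Fin n → ℝ) (R C : ℕ → Fin n → ℝ) (hR : ∀ ν p, 0 < R ν p) (hC : ∀ ν q, 0 < C ν q)
    (Δ : ℕ → ℝ) (hΔ : Tendsto Δ atTop atTop)
    (hG : ∀ p q, Tendsto (fun ν => G ν p q / (R ν p * C ν q) * Real.exp (Δ ν * a p q)) atTop (𝓝 (γ p q)))
    (m : ℝ) (hm : ∀ σ : Equiv.Perm (Fin k), m ≤ ∑ i, a (r (σ i)) (c i)) :
    ∑ σ ∈ univ.filter (fun σ : Equiv.Perm (Fin k) => ∑ i, a (r (σ i)) (c i) = m),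
      ((Equiv.Perm.sign σ : ℤ) : ℝ) * ∏ i, γ (r (σ i)) (c i) = 0 := by
  classical
  have _hN : ∀ ν, 0 < (∏ i, R ν (r i)) * ∏ i, C ν (c i) := fun ν =>
    mul_pos (Finset.prod_pos fun i _ => hR ν _) (Finset.prod_pos fun i _ => hC ν _)
  exact topClass_sum_eq_zero
    (fun ν σ => ((Equiv.Perm.sign σ : ℤ) : ℝ) * (∏ i, G ν (r (σ i)) (c i)) / ((∏ i, R ν (r i)) * ∏ i, C ν (c i)))
    (fun σ => ((Equiv.Perm.sign σ : ℤ) : ℝ) * ∏ i, γ (r (σ i)) (c i))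
    (fun σ => ∑ i, a (r (σ i)) (c i)) Δ m hΔ hm
    (fun σ => minor_term_tendsto G r c γ (fun _ => a) R C Δ hG σ)
    (minor_terms_sum_eq_zero G r c hdet R C)

/-! ## §3 Kill corollaries (robust: the excess exponents may move with `ν`) -/

/-- The sign character as a real number is `±1`, hence non-zero. [folklore] -/
theorem sign_cast_ne_zero {k : ℕ} (σ : Equiv.Perm (Fin k)) : ((Equiv.Perm.sign σ : ℤ) : ℝ) ≠ 0 := by
  rcases Int.units_eq_one_or (Equiv.Perm.sign σ) with h | h <;> simp [h]

/-- **KILL, singleton top class.**  Vanishing minor, entry asymptotics with (possibly moving) excess exponents `a^ν`, a permutation `σ₀`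
whose exponent gap to EVERY other permutation diverges after the rate (`Δ^ν·(A^ν σ − A^ν σ₀) → +∞`; e.g. a fixed positive limiting gap and
`Δ^ν → ∞`, `Filter.Tendsto.atTop_mul_pos`), and a non-zero `γ`-monomial: contradiction. [this work] -/
theorem false_of_topClass_singleton {n k : ℕ} (G : ℕ → Matrix (Fin n) (Fin n) ℝ) (r c : Fin k → Fin n)
    (hdet : ∀ ν, ((G ν).submatrix r c).det = 0)
    (γ : Fin n → Fin n → ℝ) (a : ℕ → Fin n → Fin n → ℝ) (R C : ℕ → Fin n → ℝ) (Δ : ℕ → ℝ)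
    (hG : ∀ p q, Tendsto (fun ν => G ν p q / (R ν p * C ν q) * Real.exp (Δ ν * a ν p q)) atTop (𝓝 (γ p q)))
    (σ₀ : Equiv.Perm (Fin k))
    (hgap : ∀ σ : Equiv.Perm (Fin k), σ ≠ σ₀ →
      Tendsto (fun ν => Δ ν * (∑ i, a ν (r (σ i)) (c i)) - Δ ν * (∑ i, a ν (r (σ₀ i)) (c i))) atTop atTop)
    (hne : ∏ i, γ (r (σ₀ i)) (c i) ≠ 0) : False := by
  classical
  have h := topClass_singleton_eq_zero
    (fun ν σ => ((Equiv.Perm.sign σ : ℤ) : ℝ) * (∏ i, G ν (r (σ i)) (c i)) / ((∏ i, R ν (r i)) * ∏ i, C ν (c i)))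
    (fun ν σ => Δ ν * ∑ i, a ν (r (σ i)) (c i))
    (fun σ => ((Equiv.Perm.sign σ : ℤ) : ℝ) * ∏ i, γ (r (σ i)) (c i)) σ₀
    (fun σ => minor_term_tendsto G r c γ a R C Δ hG σ) hgap (minor_terms_sum_eq_zero G r c hdet R C)
  exact (mul_ne_zero (sign_cast_ne_zero σ₀) hne) h

/-- **KILL, exact pair.**  Two permutations `σ₀ ≠ σ₁` with identical excess exponents for every `ν`, identical `γ`-monomials and signs,
divergent gaps to all others, non-zero monomial: contradiction. [this work] -/
theorem false_of_topClass_pair {n k : ℕ} (G : ℕ → Matrix (Fin n) (Fin n) ℝ) (r c : Fin k → Fin n)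
    (hdet : ∀ ν, ((G ν).submatrix r c).det = 0)
    (γ : Fin n → Fin n → ℝ) (a : ℕ → Fin n → Fin n → ℝ) (R C : ℕ → Fin n → ℝ) (Δ : ℕ → ℝ)
    (hG : ∀ p q, Tendsto (fun ν => G ν p q / (R ν p * C ν q) * Real.exp (Δ ν * a ν p q)) atTop (𝓝 (γ p q)))
    (σ₀ σ₁ : Equiv.Perm (Fin k)) (h01 : σ₀ ≠ σ₁)
    (hA1 : ∀ ν, ∑ i, a ν (r (σ₁ i)) (c i) = ∑ i, a ν (r (σ₀ i)) (c i))
    (hgap : ∀ σ : Equiv.Perm (Fin k), σ ≠ σ₀ → σ ≠ σ₁ →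
      Tendsto (fun ν => Δ ν * (∑ i, a ν (r (σ i)) (c i)) - Δ ν * (∑ i, a ν (r (σ₀ i)) (c i))) atTop atTop)
    (hmono : ∏ i, γ (r (σ₁ i)) (c i) = ∏ i, γ (r (σ₀ i)) (c i))
    (hsign : Equiv.Perm.sign σ₁ = Equiv.Perm.sign σ₀)
    (hne : ∏ i, γ (r (σ₀ i)) (c i) ≠ 0) : False := by
  classical
  have h := topClass_pair_eq_zero
    (fun ν σ => ((Equiv.Perm.sign σ : ℤ) : ℝ) * (∏ i, G ν (r (σ i)) (c i)) / ((∏ i, R ν (r i)) * ∏ i, C ν (c i)))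
    (fun ν σ => Δ ν * ∑ i, a ν (r (σ i)) (c i))
    (fun σ => ((Equiv.Perm.sign σ : ℤ) : ℝ) * ∏ i, γ (r (σ i)) (c i)) σ₀ σ₁ h01
    (fun σ => minor_term_tendsto G r c γ a R C Δ hG σ) (fun ν => by simp only [hA1 ν]) hgap
    (minor_terms_sum_eq_zero G r c hdet R C)
  simp only [hmono, hsign, ← two_mul] at h
  exact (mul_ne_zero two_ne_zero (mul_ne_zero (sign_cast_ne_zero σ₀) hne)) h

/-- For a principal minor (`c = r`) and SYMMETRIC `γ`, the monomial of `σ⁻¹` equals that of `σ`. [folklore] -/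
theorem prod_inv_perm_eq_of_symm {n k : ℕ} (γ : Fin n → Fin n → ℝ) (hγ : ∀ p q, γ p q = γ q p) (r : Fin k → Fin n)
    (σ : Equiv.Perm (Fin k)) : ∏ i, γ (r (σ⁻¹ i)) (r i) = ∏ i, γ (r (σ i)) (r i) := by
  rw [← Equiv.prod_comp σ (fun i => γ (r (σ⁻¹ i)) (r i))]
  refine Finset.prod_congr rfl fun i _ => ?_
  simp only [Equiv.Perm.coe_inv, Equiv.symm_apply_apply]
  exact hγ _ _

/-- Likewise the excess exponent of `σ⁻¹` equals that of `σ` when `a` is symmetric. [folklore] -/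
theorem sum_inv_perm_eq_of_symm {n k : ℕ} (a : Fin n → Fin n → ℝ) (ha : ∀ p q, a p q = a q p) (r : Fin k → Fin n)
    (σ : Equiv.Perm (Fin k)) : ∑ i, a (r (σ⁻¹ i)) (r i) = ∑ i, a (r (σ i)) (r i) := by
  rw [← Equiv.sum_comp σ (fun i => a (r (σ⁻¹ i)) (r i))]
  refine Finset.sum_congr rfl fun i _ => ?_
  simp only [Equiv.Perm.coe_inv, Equiv.symm_apply_apply]
  exact ha _ _

/-- **KILL, principal minor with top class `{σ₀, σ₀⁻¹}`** (`σ₀² ≠ 1`), `γ` and every `a^ν` symmetric: contradiction as soon as the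
`γ`-monomial of `σ₀` is non-zero and the gaps to all other permutations diverge.  This is the generic MIXED top class (no one-sided
matching): the census's «linking kill». [this work] -/
theorem false_of_topClass_inv_pair {n k : ℕ} (G : ℕ → Matrix (Fin n) (Fin n) ℝ) (r : Fin k → Fin n)
    (hdet : ∀ ν, ((G ν).submatrix r r).det = 0)
    (γ : Fin n → Fin n → ℝ) (a : ℕ → Fin n → Fin n → ℝ) (hγ : ∀ p q, γ p q = γ q p) (ha : ∀ ν p q, a ν p q = a ν q p)
    (R C : ℕ → Fin n → ℝ) (Δ : ℕ → ℝ)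
    (hG : ∀ p q, Tendsto (fun ν => G ν p q / (R ν p * C ν q) * Real.exp (Δ ν * a ν p q)) atTop (𝓝 (γ p q)))
    (σ₀ : Equiv.Perm (Fin k)) (hinv : σ₀ ≠ σ₀⁻¹)
    (hgap : ∀ σ : Equiv.Perm (Fin k), σ ≠ σ₀ → σ ≠ σ₀⁻¹ →
      Tendsto (fun ν => Δ ν * (∑ i, a ν (r (σ i)) (r i)) - Δ ν * (∑ i, a ν (r (σ₀ i)) (r i))) atTop atTop)
    (hne : ∏ i, γ (r (σ₀ i)) (r i) ≠ 0) : False :=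
  false_of_topClass_pair G r r hdet γ a R C Δ hG σ₀ σ₀⁻¹ hinv
    (fun ν => sum_inv_perm_eq_of_symm (a ν) (ha ν) r σ₀) hgap
    (prod_inv_perm_eq_of_symm γ hγ r σ₀) (Equiv.Perm.sign_inv σ₀) hne

/-- A fixed positive limiting gap and a divergent rate give a divergent rescaled gap (the usual way to discharge `hgap`). [folklore] -/
theorem gap_tendsto_atTop (Δ d : ℕ → ℝ) (g : ℝ) (hg : 0 < g) (hΔ : Tendsto Δ atTop atTop)
    (hd : Tendsto d atTop (𝓝 g)) : Tendsto (fun ν => Δ ν * d ν) atTop atTop :=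
  hΔ.atTop_mul_pos hg hd

/-! ## §4 The two-slope dictionary: cluster data ⇒ the entry asymptotics of §2–§3 (moving supports allowed) -/

/-- **TWO-SLOPE DICTIONARY.**  Gram sequence `G^ν`; letters' exponents `δ^ν` (they may move with `ν`); a hinge MEMBER `(p₀,q₀)` with value
`v^ν = δ^ν p₀ + δ^ν q₀`; centres `s₁^ν, s₂^ν`; normalisers `μ₁, μ₂ > 0`; a side assignment `B` (below/above the hinge, constant in `ν`) with the
cluster limits: below `G_pq e^{w s₁}/μ₁ → Γ₁(pq)`, above `G_pq e^{w s₂}/μ₂ → Γ₂(pq)` (`w = δ^ν p + δ^ν q`), the hinge member alive in both.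
Then with the row/column normalisers `N^ν_p := √μ₁ · exp(−v s₁/2 − s̄ (δ^ν p − v/2))` (`s̄ = (s₁+s₂)/2`), the rate `Δ = (s₂ − s₁)/2` and the
moving excess exponents `a^ν_pq = |w^ν − v^ν|`, EVERY entry satisfies `G_pq /(N_p N_q) · e^{Δ a^ν_pq} → γ_pq`, `γ = Γ₁` below and `κ·Γ₂` above,
`κ = Γ₁(h)/Γ₂(h)` (non-zero when the hinge member is alive below, `div_ne_zero`) — one glued matrix `γ`, non-zero exactly at the alive members
(`glued_ne_zero_iff`).  BOOKKEEPING FOR THE USER (crit-2 g5, 01:07Z): members OTHER than `(p₀,q₀)` sharing the hinge value (at a Weyl face: the second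
member of a doubleton, the triple) are sent by the decidable flag `B` to ONE side and must satisfy that side's package limit (`h1` resp. `h2`); the two
formulas agree on such a member exactly when `Γ₁(pq) = κ·Γ₂(pq)`, which holds automatically for every member having BOTH limits (same computation as for
the hinge member), so the choice of side is immaterial for members alive in both clusters and must point to the alive side otherwise.  No order
hypothesis `s₁ < s₂` is needed here; divergence of `(s₂ − s₁)/2` enters only at kill time (`hgap`, `gap_tendsto_atTop`).  (Inputs in the tree: the cluster packages of W2 #22/#26
`confluentClusters`/`tightChain`; cf. W2 #29 `scaleRatio_lower/upper`.) [this work] -/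
theorem twoSlope_dictionary {n : ℕ} (G : ℕ → Matrix (Fin n) (Fin n) ℝ) (δ : ℕ → Fin n → ℝ) (p₀ q₀ : Fin n)
    (s₁ s₂ μ₁ μ₂ : ℕ → ℝ) (hμ₁ : ∀ ν, 0 < μ₁ ν) (hμ₂ : ∀ ν, 0 < μ₂ ν)
    (Γ₁ Γ₂ : Fin n → Fin n → ℝ) (B : Fin n → Fin n → Prop) [DecidableRel B]
    (hB : ∀ p q, B p q → ∀ ν, δ ν p + δ ν q ≤ δ ν p₀ + δ ν q₀)
    (hB' : ∀ p q, ¬ B p q → ∀ ν, δ ν p₀ + δ ν q₀ ≤ δ ν p + δ ν q)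
    (h1 : ∀ p q, B p q →
      Tendsto (fun ν => G ν p q * Real.exp ((δ ν p + δ ν q) * s₁ ν) / μ₁ ν) atTop (𝓝 (Γ₁ p q)))
    (h2 : ∀ p q, ¬ B p q →
      Tendsto (fun ν => G ν p q * Real.exp ((δ ν p + δ ν q) * s₂ ν) / μ₂ ν) atTop (𝓝 (Γ₂ p q)))
    (hh1 : Tendsto (fun ν => G ν p₀ q₀ * Real.exp ((δ ν p₀ + δ ν q₀) * s₁ ν) / μ₁ ν) atTop (𝓝 (Γ₁ p₀ q₀)))
    (hh2 : Tendsto (fun ν => G ν p₀ q₀ * Real.exp ((δ ν p₀ + δ ν q₀) * s₂ ν) / μ₂ ν) atTop (𝓝 (Γ₂ p₀ q₀)))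
    (hne2 : Γ₂ p₀ q₀ ≠ 0) :
    ∀ p q, Tendsto (fun ν => G ν p q /
        ((Real.sqrt (μ₁ ν) * Real.exp (-((δ ν p₀ + δ ν q₀) * s₁ ν) / 2 - (s₁ ν + s₂ ν) / 2 * (δ ν p - (δ ν p₀ + δ ν q₀) / 2))) *
         (Real.sqrt (μ₁ ν) * Real.exp (-((δ ν p₀ + δ ν q₀) * s₁ ν) / 2 - (s₁ ν + s₂ ν) / 2 * (δ ν q - (δ ν p₀ + δ ν q₀) / 2))))
        * Real.exp ((s₂ ν - s₁ ν) / 2 * |δ ν p + δ ν q - (δ ν p₀ + δ ν q₀)|)) atTop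
      (𝓝 (if B p q then Γ₁ p q else (Γ₁ p₀ q₀ / Γ₂ p₀ q₀) * Γ₂ p q)) := by
  intro p q
  -- the normaliser in closed form
  have hnorm : ∀ ν, (Real.sqrt (μ₁ ν) * Real.exp (-((δ ν p₀ + δ ν q₀) * s₁ ν) / 2
        - (s₁ ν + s₂ ν) / 2 * (δ ν p - (δ ν p₀ + δ ν q₀) / 2))) *
      (Real.sqrt (μ₁ ν) * Real.exp (-((δ ν p₀ + δ ν q₀) * s₁ ν) / 2
        - (s₁ ν + s₂ ν) / 2 * (δ ν q - (δ ν p₀ + δ ν q₀) / 2)))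
      = μ₁ ν * Real.exp (-((δ ν p₀ + δ ν q₀) * s₁ ν)
        - (s₁ ν + s₂ ν) / 2 * (δ ν p + δ ν q - (δ ν p₀ + δ ν q₀))) := by
    intro ν
    have hs : Real.sqrt (μ₁ ν) * Real.sqrt (μ₁ ν) = μ₁ ν := Real.mul_self_sqrt (hμ₁ ν).le
    calc _ = (Real.sqrt (μ₁ ν) * Real.sqrt (μ₁ ν)) *
          (Real.exp (-((δ ν p₀ + δ ν q₀) * s₁ ν) / 2 - (s₁ ν + s₂ ν) / 2 * (δ ν p - (δ ν p₀ + δ ν q₀) / 2)) *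
           Real.exp (-((δ ν p₀ + δ ν q₀) * s₁ ν) / 2 - (s₁ ν + s₂ ν) / 2 * (δ ν q - (δ ν p₀ + δ ν q₀) / 2))) := by ring
      _ = _ := by rw [hs, ← Real.exp_add]; congr 1; ring
  simp_rw [hnorm]
  set E : ℕ → ℝ := fun ν => -((δ ν p₀ + δ ν q₀) * s₁ ν)
      - (s₁ ν + s₂ ν) / 2 * (δ ν p + δ ν q - (δ ν p₀ + δ ν q₀)) with hE
  by_cases hb : B p q
  · -- below (weakly): the exponents combine to `w·s₁`
    rw [if_pos hb]
    have key : ∀ ν, G ν p q / (μ₁ ν * Real.exp (E ν))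
          * Real.exp ((s₂ ν - s₁ ν) / 2 * |δ ν p + δ ν q - (δ ν p₀ + δ ν q₀)|)
        = G ν p q * Real.exp ((δ ν p + δ ν q) * s₁ ν) / μ₁ ν := by
      intro ν
      have habs : |δ ν p + δ ν q - (δ ν p₀ + δ ν q₀)| = -(δ ν p + δ ν q - (δ ν p₀ + δ ν q₀)) :=
        abs_of_nonpos (sub_nonpos.mpr (hB p q hb ν))
      have hx : Real.exp ((δ ν p + δ ν q) * s₁ ν)
          = Real.exp ((s₂ ν - s₁ ν) / 2 * |δ ν p + δ ν q - (δ ν p₀ + δ ν q₀)|) / Real.exp (E ν) := by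
        rw [← Real.exp_sub, habs, hE]
        congr 1
        ring
      rw [hx]
      have h1' : μ₁ ν ≠ 0 := (hμ₁ ν).ne'
      have h2' : Real.exp (E ν) ≠ 0 := Real.exp_ne_zero _
      field_simp
    exact (h1 p q hb).congr' (Eventually.of_forall fun ν => (key ν).symm)
  · -- above (weakly): route through cluster 2 and the hinge ratio
    rw [if_neg hb]
    have hratio : Tendsto (fun ν => μ₂ ν / μ₁ ν * Real.exp ((δ ν p₀ + δ ν q₀) * (s₁ ν - s₂ ν))) atTop
        (𝓝 (Γ₁ p₀ q₀ / Γ₂ p₀ q₀)) := by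
      have hev : ∀ᶠ ν in atTop, G ν p₀ q₀ * Real.exp ((δ ν p₀ + δ ν q₀) * s₂ ν) / μ₂ ν ≠ 0 :=
        hh2.eventually_ne hne2
      refine (hh1.div hh2 hne2).congr' (hev.mono fun ν hν => ?_)
      have hG0 : G ν p₀ q₀ ≠ 0 := by
        intro h0; apply hν; rw [h0, zero_mul, zero_div]
      have h1' : μ₁ ν ≠ 0 := (hμ₁ ν).ne'
      have h2' : μ₂ ν ≠ 0 := (hμ₂ ν).ne'
      have hx : Real.exp ((δ ν p₀ + δ ν q₀) * (s₁ ν - s₂ ν))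
          = Real.exp ((δ ν p₀ + δ ν q₀) * s₁ ν) / Real.exp ((δ ν p₀ + δ ν q₀) * s₂ ν) := by
        rw [← Real.exp_sub]
        congr 1
        ring
      simp only [Pi.div_apply]
      rw [hx]
      have h3' : Real.exp ((δ ν p₀ + δ ν q₀) * s₂ ν) ≠ 0 := Real.exp_ne_zero _
      field_simp
    have key : ∀ ν, G ν p q / (μ₁ ν * Real.exp (E ν))
          * Real.exp ((s₂ ν - s₁ ν) / 2 * |δ ν p + δ ν q - (δ ν p₀ + δ ν q₀)|)
        = (G ν p q * Real.exp ((δ ν p + δ ν q) * s₂ ν) / μ₂ ν)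
          * (μ₂ ν / μ₁ ν * Real.exp ((δ ν p₀ + δ ν q₀) * (s₁ ν - s₂ ν))) := by
      intro ν
      have habs : |δ ν p + δ ν q - (δ ν p₀ + δ ν q₀)| = δ ν p + δ ν q - (δ ν p₀ + δ ν q₀) :=
        abs_of_nonneg (sub_nonneg.mpr (hB' p q hb ν))
      have hx : Real.exp ((s₂ ν - s₁ ν) / 2 * |δ ν p + δ ν q - (δ ν p₀ + δ ν q₀)|)
          = Real.exp (E ν) * (Real.exp ((δ ν p + δ ν q) * s₂ ν)
            * Real.exp ((δ ν p₀ + δ ν q₀) * (s₁ ν - s₂ ν))) := by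
        rw [← Real.exp_add, ← Real.exp_add, habs, hE]
        congr 1
        ring
      rw [hx]
      have h1' : μ₁ ν ≠ 0 := (hμ₁ ν).ne'
      have h2' : μ₂ ν ≠ 0 := (hμ₂ ν).ne'
      have h3' : Real.exp (E ν) ≠ 0 := Real.exp_ne_zero _
      field_simp
    rw [mul_comm (Γ₁ p₀ q₀ / Γ₂ p₀ q₀) (Γ₂ p q)]
    exact ((h2 p q hb).mul hratio).congr' (Eventually.of_forall fun ν => (key ν).symm)

/-- The glued matrix of the dictionary is non-zero exactly where the cluster limit owning the member is: below the hinge `γ_pq ≠ 0 ↔ Γ₁(pq) ≠ 0`,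
above it `γ_pq ≠ 0 ↔ Γ₂(pq) ≠ 0` (`κ ≠ 0`). [folklore] -/
theorem glued_ne_zero_iff {n : ℕ} (Γ₁ Γ₂ : Fin n → Fin n → ℝ) (B : Fin n → Fin n → Prop) [DecidableRel B] (κ : ℝ) (hκ : κ ≠ 0)
    (p q : Fin n) : (if B p q then Γ₁ p q else κ * Γ₂ p q) ≠ 0 ↔ (B p q ∧ Γ₁ p q ≠ 0) ∨ (¬ B p q ∧ Γ₂ p q ≠ 0) := by
  by_cases hb : B p q
  · simp [hb]
  · simp [hb, hκ]

end Summit.ValiantsHypothesis.ValiantsHypothesis.Theorems.LacunarySymmetroidMatrixDescartes.WallBubbling
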